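import Summits.Parity.GeneralizedHardyLittlewood.Theses.LeeYangFibres
import Summits.Parity.GeneralizedHardyLittlewood.Theorems.LeeYangFibresCellsToRelativeDimOneCounts
import HarnessLib

/-!
# `LeeYangFibres.CellsToRelativeDimOne` (stmt-Parity-14115): from prime cells to the relative `d = 1` asymptotic

We prove the support item `CellsToRelativeDimOne := PrimeCellsRelative → RelativeDimOne` of route
`LeeYangFibres` (Parity / GeneralizedHardyLittlewood): the counting asymptotic for the cells
`C = #{n ∈ K ∩ [-N,N] : every ψᵢ(n) a prime > N^{1/u}}`,
`|C - β_∞ ∏_p β_p (A₁(N)/N)^t| ≤ ε (β_∞ ∏_p β_p (A₁(N)/N)^t + N / log^t N)`,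
`A₁(N) = #{N^{1/u} < p ≤ N}`, uniformly over nondegenerate `d = 1` systems of size `≤ L` and
convex `K ⊆ [-N, N]`, implies the von Mangoldt asymptotic with Green–Tao's Conj. 1.4 error shape,
`|∑_{n ∈ K} ∏ᵢ Λ(ψᵢ(n)) - β_∞ ∏_p β_p| ≤ ε (β_∞ ∏_p β_p + N)`.

## Proof (partial summation in the form of Green–Tao's sketch after (1.8), run backwards)

Fix `t, L, ε`; put `ε₀ = min ε 1`, `a = ε₀/16`, choose `η` with `(1 ± η)^t ∈ [1 - a, 1 + a]`
(`exists_eta_pow_near_one`) and apply `PrimeCellsRelative` at precision `a` (this fixes `u ≥ 2`).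
At a scale `N` put `ℓ = log N`, `T = ℓ^t`, `Y = N/ℓ^{t+1}`.
* The SANDWICH `vonMangoldtSum_primePointCount_sandwich` of
  `Literature/NumberTheory/Sieve/LinearEquationsInPrimesCountSandwich` (threshold `Y`,
  `a = (1-η)ℓ ≤ log Y`, `b = (1+η)ℓ ≥ log(2LN)`) gives `g, β, γ ≥ 0` with
  `((1-η)ℓ)^t g ≤ S ≤ ((1+η)ℓ)^t (g + β + γ)`, `g ≤ P ≤ g + β` (`P` = number of prime points),
  `β ≤ t(2Y+1)`, `γ ≤ t √(2LN) log₂(2LN)`; no decomposition of `K` is needed.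
* The cell count satisfies `C ≤ P ≤ C + t(2N^{1/u}+1)` (a prime point outside the cells has a
  prime value `≤ N^{1/u}`), so `TC - Tβ ≤ Tg ≤ TC + Tβ₂`.
* `T β, T γ, T β₂ = o(N)` by `eventually_log_growth` (`ℓ → ∞`, `ℓ^{t+1} = o(√N)`).
* `κ = (A₁ ℓ/N)^t ∈ [(1-η)^t, (1+η)^t]` by the prime number theorem
  (`eventually_primeCounting_window`, from `Literature.NumberTheory.LFunctions` — PROVED in the
  tree — and `π(N) - √N ≤ A₁ ≤ π(N)`), so `PrimeCellsRelative × T` reads `|TC - κM| ≤ a(κM + N)`.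
* `cells_arith` concludes, distinguishing the sign of `M = β_∞ ∏_p β_p` (the singular product is
  an ordered `limUnder` and not known to be nonnegative a priori; for `M < 0` the cell asymptotic
  with `C ≥ 0` forces `|M| = O(aN)`).

References: B. Green, T. Tao, *Linear equations in primes*, Ann. of Math. 171 (2010), Conj. 1.4
and the sketch proof after (1.8) [GreenTao2010]; H. L. Montgomery, R. C. Vaughan,
*Multiplicative Number Theory I* (2007), §8.1 [MontgomeryVaughan2007].
-/

noncomputable section

namespace Summit.Parity.GeneralizedHardyLittlewood.Theorems.LeeYangFibresCells

open Filter Finset Asymptotics Literature.NumberTheory.Sieve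
open scoped Topology

/-- **Main step at one scale `N`.** Under the growth conditions on `ℓ = log N` listed as
hypotheses (all eventually true), the comparison `C ≤ P ≤ C + t(2N^{1/u}+1)` of the cell count
`Cn` with the prime-point count, the window `π(N) - N^{1/u} ≤ A₁ ≤ π(N)` for the rough prime
count and the cell asymptotic `|Cn - M (A₁/N)^t| ≤ (ε₀/16)(M (A₁/N)^t + N/ℓ^t)`, one has
`|∑ ∏ Λ(ψᵢ(n)) - M| ≤ ε (M + N)`. (`Cn, A₁, M` are real parameters, instantiated in
`cellsToRelativeDimOne_proof` by the two counts of `PrimeCellsRelative` and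
`β_∞ ∏_p β_p`.) [cite: GreenTao2010, Conj. 1.4 (sketch proof)] -/
theorem abs_vonMangoldtSum_sub_le_of_cells {t L N u : ℕ} {ε ε₀ η c₂ Cn A₁ M : ℝ}
    (Ψ : Fin t → AffLinForm 1) (K : Set (Fin 1 → ℝ)) (ht : 1 ≤ t) (hN3 : 3 ≤ N) (hu2 : 2 ≤ u)
    (hε₀ : 0 < ε₀) (hε₀1 : ε₀ ≤ 1) (hε₀ε : ε₀ ≤ ε) (hη2 : η ≤ 1 / 2)
    (hηp : (1 + η) ^ t ≤ 1 + ε₀ / 16) (hηm : 1 - ε₀ / 16 ≤ (1 - η) ^ t)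
    (hΨ : IsNondegenerateSystem Ψ) (hL : affLinSize Ψ N ≤ L) (hc₂0 : 0 < c₂)
    (hc₂ : 12 * t * (Real.sqrt (2 * L) + 1) * c₂ ≤ ε₀ / 16)
    (hℓL : Real.log (2 * L) ≤ η * Real.log N) (hℓt : 144 * t ≤ ε₀ * Real.log N)
    (hloglog : (t + 1 : ℝ) * Real.log (Real.log N) ≤ η * Real.log N)
    (hℓpow : Real.log N ^ (t + 1) ≤ 1 * N) (hℓsqrt : Real.log N ^ (t + 1) ≤ c₂ * Real.sqrt N)
    (hwin : ∀ A : ℝ, (Nat.primeCounting N : ℝ) - Real.sqrt N ≤ A → A ≤ Nat.primeCounting N →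
      (1 - η) * N ≤ A * Real.log N ∧ A * Real.log N ≤ (1 + η) * N)
    (hPCR : |Cn - M * (A₁ / N) ^ t| ≤ ε₀ / 16 * (M * (A₁ / N) ^ t + N / Real.log N ^ t))
    (hC0 : 0 ≤ Cn) (hC1 : Cn ≤ primePointCount Ψ K N)
    (hC2 : (primePointCount Ψ K N : ℝ) ≤ Cn + t * (2 * (N : ℝ) ^ ((1 : ℝ) / u) + 1))
    (hA1 : (Nat.primeCounting N : ℝ) ≤ A₁ + (N : ℝ) ^ ((1 : ℝ) / u))
    (hA2 : A₁ ≤ Nat.primeCounting N) :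
    |vonMangoldtSum Ψ K N - M| ≤ ε * (M + N) := by
  have hN1 : 1 ≤ N := by omega
  have hx1 : (1 : ℝ) ≤ N := by exact_mod_cast hN1
  have hx3 : (3 : ℝ) ≤ N := by exact_mod_cast hN3
  have hx0 : (0 : ℝ) < N := by linarith
  have ht0 : (0 : ℝ) < t := by exact_mod_cast ht
  have hℓ1 : 1 < Real.log N := by
    rw [Real.lt_log_iff_exp_lt hx0]
    linarith [Real.exp_one_lt_d9]
  set ℓ : ℝ := Real.log N with hℓdef
  have hℓ0 : 0 < ℓ := by linarith
  set T : ℝ := ℓ ^ t with hTdef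
  have hT : 0 < T := pow_pos hℓ0 t
  have hℓt1 : 0 < ℓ ^ (t + 1) := pow_pos hℓ0 _
  have hTℓ : T * ℓ = ℓ ^ (t + 1) := by rw [hTdef, pow_succ]
  have hTle : T ≤ ℓ ^ (t + 1) := by
    rw [← hTℓ]
    exact le_mul_of_one_le_right hT.le hℓ1.le
  obtain ⟨i₀⟩ : Nonempty (Fin t) := ⟨⟨0, ht⟩⟩
  have hL1 : (1 : ℝ) ≤ L := one_le_of_affLinSize_le Ψ hΨ hL i₀
  have hηℓ : η * ℓ ≤ 1 / 2 * ℓ := mul_le_mul_of_nonneg_right hη2 hℓ0.le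
  -- the threshold `Y = N / ℓ^{t+1}`
  set Y : ℝ := N / ℓ ^ (t + 1) with hYdef
  have hY1 : 1 ≤ Y := by
    rw [hYdef, le_div_iff₀ hℓt1, one_mul]
    linarith
  have hY0 : 0 < Y := by linarith
  have hlogY : (1 - η) * ℓ ≤ Real.log Y := by
    rw [hYdef, Real.log_div hx0.ne' hℓt1.ne', Real.log_pow, ← hℓdef]
    push_cast
    linarith
  have ha0' : 0 ≤ (1 - η) * ℓ := mul_nonneg (by linarith) hℓ0.le
  have hb : Real.log (2 * L * N) ≤ (1 + η) * ℓ := by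
    rw [Real.log_mul (by positivity) hx0.ne', ← hℓdef]
    linarith
  -- the sandwich
  obtain ⟨g, β, γ, hg, hβ, hγ, hS1, hS2, hP1, hP2, hβle, hγle⟩ :=
    vonMangoldtSum_primePointCount_sandwich hN1 Ψ hΨ hL K ht hY1 ha0' hlogY hb
  simp only [Nat.sub_self, pow_zero, mul_one] at hβle hγle
  -- `Z = N^{1/u} ≤ √N` and the PNT window for `A₁`
  have hZ : (N : ℝ) ^ ((1 : ℝ) / u) ≤ Real.sqrt N := by
    rw [Real.sqrt_eq_rpow]
    refine Real.rpow_le_rpow_of_exponent_le hx1 ?_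
    have hu : (2 : ℝ) ≤ u := by exact_mod_cast hu2
    exact one_div_le_one_div_of_le two_pos hu
  have hZ0 : 0 ≤ (N : ℝ) ^ ((1 : ℝ) / u) := by positivity
  obtain ⟨hAlo, hAhi⟩ := hwin A₁ (by linarith only [hA1, hZ]) hA2
  have hA0 : 0 ≤ A₁ := by
    refine le_of_mul_le_mul_right ?_ hℓ0
    have : 0 ≤ (1 - η) * (N : ℝ) := mul_nonneg (by linarith only [hη2]) hx0.le
    linarith only [this, hAlo]
  -- `κ = (A₁ ℓ / N)^t ∈ [1 - ε₀/16, 1 + ε₀/16]`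
  set κ : ℝ := (A₁ / N) ^ t * T with hκdef
  have hκeq : κ = (A₁ * ℓ / N) ^ t := by
    rw [hκdef, hTdef, ← mul_pow, div_mul_eq_mul_div]
  have hκlo : 1 - ε₀ / 16 ≤ κ := by
    rw [hκeq]
    refine hηm.trans (pow_le_pow_left₀ (by linarith only [hη2]) ?_ t)
    rw [le_div_iff₀ hx0]
    linarith only [hAlo]
  have hκhi : κ ≤ 1 + ε₀ / 16 := by
    rw [hκeq]
    refine le_trans (pow_le_pow_left₀ (div_nonneg (mul_nonneg hA0 hℓ0.le) hx0.le) ?_ t) hηp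
    rw [div_le_iff₀ hx0]
    linarith only [hAhi]
  -- `PrimeCellsRelative` rescaled by `T = ℓ^t`
  have hPCR2 : |T * Cn - M * κ| ≤ ε₀ / 16 * (M * κ + N) := by
    have h1 := mul_le_mul_of_nonneg_left hPCR hT.le
    have h2 : T * |Cn - M * (A₁ / N) ^ t| = |T * Cn - M * κ| := by
      rw [← abs_of_pos hT, ← abs_mul, abs_of_pos hT]
      congr 1
      rw [hκdef]
      ring
    have hTN : T * (N / T) = N := mul_div_cancel₀ _ hT.ne'
    have h3 : T * (ε₀ / 16 * (M * (A₁ / N) ^ t + N / T)) = ε₀ / 16 * (M * κ + N) := by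
      calc T * (ε₀ / 16 * (M * (A₁ / N) ^ t + N / T))
          = ε₀ / 16 * (M * ((A₁ / N) ^ t * T) + T * (N / T)) := by ring
        _ = ε₀ / 16 * (M * κ + N) := by rw [hTN]
    rw [h2, h3] at h1
    exact h1
  -- smallness of the three error counts
  have hYℓ : Y * ℓ ^ (t + 1) = N := div_mul_cancel₀ _ hℓt1.ne'
  have hTY : T * Y * ℓ = N := by
    calc T * Y * ℓ = Y * (T * ℓ) := by ring
      _ = Y * ℓ ^ (t + 1) := by rw [hTℓ]
      _ = N := hYℓ
  have hEb : T * β ≤ ε₀ / 48 * N := by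
    have h1 : T * β ≤ 3 * t * (T * Y) := by
      calc T * β ≤ T * (t * (2 * Y + 1)) := mul_le_mul_of_nonneg_left hβle hT.le
        _ ≤ T * (t * (3 * Y)) :=
            mul_le_mul_of_nonneg_left (mul_le_mul_of_nonneg_left (by linarith only [hY1]) ht0.le)
              hT.le
        _ = 3 * t * (T * Y) := by ring
    have h2 : 3 * t * (T * Y) * ℓ ≤ ε₀ / 48 * N * ℓ := by
      calc 3 * t * (T * Y) * ℓ = 3 * t * (T * Y * ℓ) := by ring
        _ = 3 * t * N := by rw [hTY]
        _ = (144 * t) * N / 48 := by ring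
        _ ≤ (ε₀ * ℓ) * N / 48 :=
            div_le_div_of_nonneg_right (mul_le_mul_of_nonneg_right hℓt hx0.le) (by norm_num)
        _ = ε₀ / 48 * N * ℓ := by ring
    have h3 : 3 * t * (T * Y) ≤ ε₀ / 48 * N := le_of_mul_le_mul_right h2 hℓ0
    exact h1.trans h3
  have hsx : Real.sqrt N * Real.sqrt N = N := Real.mul_self_sqrt hx0.le
  have hs1 : 1 ≤ Real.sqrt (N : ℝ) := by
    rw [show (1 : ℝ) = Real.sqrt 1 from Real.sqrt_one.symm]
    exact Real.sqrt_le_sqrt hx1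
  have hEc : T * γ ≤ ε₀ / 48 * N := by
    have hs : (Nat.sqrt (2 * L * N) : ℝ) ≤ Real.sqrt (2 * L) * Real.sqrt N := by
      have h1 := Real.nat_sqrt_le_real_sqrt (a := 2 * L * N)
      push_cast at h1
      rwa [Real.sqrt_mul (by positivity)] at h1
    have hlg : (Nat.log 2 (2 * L * N) : ℝ) ≤ 4 * ℓ := by
      have h1 : ((Nat.log 2 (2 * L * N) : ℕ) : ℝ) ≤ Real.logb 2 (2 * L * N) := by
        have := Real.natLog_le_logb (2 * L * N) 2
        exact_mod_cast this
      have h2 : Real.logb 2 (2 * (L : ℝ) * N) ≤ 4 * ℓ := by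
        rw [Real.logb, div_le_iff₀ (Real.log_pos one_lt_two)]
        have h3 : Real.log (2 * L * N) ≤ 2 * ℓ := hb.trans (by linarith only [hηℓ, hℓ0])
        have h4 := Real.log_two_gt_d9
        have h5 : 1 / 2 * ℓ ≤ Real.log 2 * ℓ :=
          mul_le_mul_of_nonneg_right (by linarith only [h4]) hℓ0.le
        linarith only [h3, h5, hℓ0]
      exact h1.trans h2
    have hkey : 4 * t * Real.sqrt (2 * L) * c₂ ≤ ε₀ / 48 := by
      have h1 : 4 * t * Real.sqrt (2 * L) * c₂ ≤ 4 * t * (Real.sqrt (2 * L) + 1) * c₂ :=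
        mul_le_mul_of_nonneg_right
          (mul_le_mul_of_nonneg_left (by linarith only) (by positivity)) hc₂0.le
      linarith only [h1, hc₂]
    calc T * γ
        ≤ T * (t * ((Nat.sqrt (2 * L * N) : ℝ) * (Nat.log 2 (2 * L * N) : ℝ))) :=
          mul_le_mul_of_nonneg_left hγle hT.le
      _ ≤ T * (t * (Real.sqrt (2 * L) * Real.sqrt N * (4 * ℓ))) :=
          mul_le_mul_of_nonneg_left (mul_le_mul_of_nonneg_left
            (mul_le_mul hs hlg (Nat.cast_nonneg _) (by positivity)) ht0.le) hT.le
      _ = 4 * t * Real.sqrt (2 * L) * Real.sqrt N * (T * ℓ) := by ring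
      _ ≤ 4 * t * Real.sqrt (2 * L) * Real.sqrt N * (c₂ * Real.sqrt N) := by
          refine mul_le_mul_of_nonneg_left ?_ (by positivity)
          rw [hTℓ]
          exact hℓsqrt
      _ = 4 * t * Real.sqrt (2 * L) * c₂ * (Real.sqrt N * Real.sqrt N) := by ring
      _ = 4 * t * Real.sqrt (2 * L) * c₂ * N := by rw [hsx]
      _ ≤ ε₀ / 48 * N := mul_le_mul_of_nonneg_right hkey hx0.le
  have hEb2 : T * (t * (2 * (N : ℝ) ^ ((1 : ℝ) / u) + 1)) ≤ ε₀ / 64 * N := by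
    have hkey : 3 * t * c₂ ≤ ε₀ / 64 := by
      have h0 : 0 ≤ Real.sqrt (2 * (L : ℝ)) := Real.sqrt_nonneg _
      have h1 : 3 * t * c₂ ≤ 3 * t * (Real.sqrt (2 * L) + 1) * c₂ := by
        have h2 : 3 * (t : ℝ) * 1 ≤ 3 * t * (Real.sqrt (2 * L) + 1) :=
          mul_le_mul_of_nonneg_left (by linarith only [h0]) (by positivity)
        have := mul_le_mul_of_nonneg_right h2 hc₂0.le
        linarith only [this]
      linarith only [h1, hc₂]
    calc T * (t * (2 * (N : ℝ) ^ ((1 : ℝ) / u) + 1))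
        ≤ T * (t * (2 * Real.sqrt N + Real.sqrt N)) :=
          mul_le_mul_of_nonneg_left (mul_le_mul_of_nonneg_left (by linarith only [hZ, hs1]) ht0.le)
            hT.le
      _ = 3 * t * Real.sqrt N * T := by ring
      _ ≤ 3 * t * Real.sqrt N * (c₂ * Real.sqrt N) :=
          mul_le_mul_of_nonneg_left (hTle.trans hℓsqrt) (by positivity)
      _ = 3 * t * c₂ * (Real.sqrt N * Real.sqrt N) := by ring
      _ = 3 * t * c₂ * N := by rw [hsx]
      _ ≤ ε₀ / 64 * N := mul_le_mul_of_nonneg_right hkey hx0.le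
  -- feed the arithmetic lemma
  have hlo : (1 - ε₀ / 16) * T ≤ ((1 - η) * ℓ) ^ t := by
    rw [mul_pow]
    exact mul_le_mul_of_nonneg_right hηm hT.le
  have hhi : ((1 + η) * ℓ) ^ t ≤ (1 + ε₀ / 16) * T := by
    rw [mul_pow]
    exact mul_le_mul_of_nonneg_right hηp hT.le
  refine cells_arith (Tg := T * g) (Tb := T * β) (Tc := T * γ)
    (Tb2 := T * (t * (2 * (N : ℝ) ^ ((1 : ℝ) / u) + 1))) (TC := T * Cn) (MK := M * κ)
    hε₀ hε₀1 hε₀ε hx0 (mul_nonneg hT.le hg) (mul_nonneg hT.le hβ) (mul_nonneg hT.le hγ)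
    (by positivity) (mul_nonneg hT.le hC0) ?_ ?_ ?_ ?_ hPCR2 ?_ ?_ ?_
  · -- lower sandwich
    calc (1 - ε₀ / 16) * (T * g) = (1 - ε₀ / 16) * T * g := by ring
      _ ≤ ((1 - η) * ℓ) ^ t * g := mul_le_mul_of_nonneg_right hlo hg
      _ ≤ _ := hS1
  · -- upper sandwich
    calc vonMangoldtSum Ψ K N ≤ ((1 + η) * ℓ) ^ t * (g + β + γ) := hS2
      _ ≤ (1 + ε₀ / 16) * T * (g + β + γ) :=
          mul_le_mul_of_nonneg_right hhi (by linarith only [hg, hβ, hγ])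
      _ = (1 + ε₀ / 16) * (T * g + T * β + T * γ) := by ring
  · -- `T Cn - T β ≤ T g`
    have h1 : Cn - β ≤ g := by linarith only [hC1, hP2]
    have h2 := mul_le_mul_of_nonneg_left h1 hT.le
    linarith only [h2]
  · -- `T g ≤ T Cn + T β₂`
    have h1 : g ≤ Cn + t * (2 * (N : ℝ) ^ ((1 : ℝ) / u) + 1) := by linarith only [hP1, hC2]
    have h2 := mul_le_mul_of_nonneg_left h1 hT.le
    linarith only [h2]
  · intro hM
    constructor
    · have := mul_le_mul_of_nonneg_left hκlo hM
      linarith only [this]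
    · have := mul_le_mul_of_nonneg_left hκhi hM
      linarith only [this]
  · intro hM
    constructor
    · have := mul_le_mul_of_nonpos_left hκhi hM.le
      linarith only [this]
    · have := mul_le_mul_of_nonpos_left hκlo hM.le
      linarith only [this]
  · have hεN : 0 ≤ ε₀ * N := by positivity
    linarith only [hEb, hEc, hEb2, hεN]


/-- **`CellsToRelativeDimOne`** (item stmt-Parity-14115 of route `LeeYangFibres`):
`PrimeCellsRelative → RelativeDimOne` — the prime-cell counting asymptotic with relative +
absolute error implies the `Λ`-weighted `d = 1` asymptotic with the error
`ε (β_∞ ∏_p β_p + N)` of Green–Tao's Conjecture 1.4, uniformly over nondegenerate systems of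
size `≤ L` and convex `K ⊆ [-N, N]`. [cite: GreenTao2010, Conj. 1.4 (sketch proof)] -/
theorem cellsToRelativeDimOne_proof :
    Summit.Parity.GeneralizedHardyLittlewood.Theses.LeeYangFibres.CellsToRelativeDimOne := by
  intro hPCR t L ht ε hε
  -- precision bookkeeping: `ε₀ = min ε 1`, `η = η(ε₀/16)`, the cells at precision `ε₀/16`
  set ε₀ : ℝ := min ε 1 with hε₀def
  have hε₀ : 0 < ε₀ := lt_min hε one_pos
  have hε₀1 : ε₀ ≤ 1 := min_le_right _ _
  have hε₀ε : ε₀ ≤ ε := min_le_left _ _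
  have ha0 : 0 < ε₀ / 16 := by positivity
  obtain ⟨η, hη0, hη2, hηp, hηm⟩ := exists_eta_pow_near_one t ha0
  obtain ⟨u, hu2, N₁, hN₁⟩ := hPCR t L ht (ε₀ / 16) ha0
  obtain ⟨N₂, hN₂⟩ := Filter.eventually_atTop.mp (eventually_primeCounting_window hη0)
  -- growth conditions on the scale
  have hden : (0 : ℝ) < 12 * t * (Real.sqrt (2 * L) + 1) := by
    have ht0 : (0 : ℝ) < t := by exact_mod_cast ht
    positivity
  set c₂ : ℝ := ε₀ / 16 / (12 * t * (Real.sqrt (2 * L) + 1)) with hc₂def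
  have hc₂0 : 0 < c₂ := div_pos ha0 hden
  have hc₂ : 12 * t * (Real.sqrt (2 * L) + 1) * c₂ ≤ ε₀ / 16 := by
    rw [hc₂def, mul_div_cancel₀ _ hden.ne']
  obtain ⟨N₃, hN₃⟩ := Filter.eventually_atTop.mp (eventually_log_growth t
    (max (Real.log (2 * L) / η) (144 * t / ε₀)) hη0 one_pos hc₂0)
  refine ⟨max N₁ (max N₂ (max N₃ 3)), fun N hN Ψ hΨ hL K hK hKN => ?_⟩
  have hNN₁ : N₁ ≤ N := le_trans (le_max_left _ _) hN
  have hNN₂ : N₂ ≤ N := le_trans ((le_max_left _ _).trans (le_max_right _ _)) hN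
  have hNN₃ : N₃ ≤ N :=
    le_trans ((le_max_left _ _).trans ((le_max_right _ _).trans (le_max_right _ _))) hN
  have hN3 : 3 ≤ N :=
    le_trans ((le_max_right _ _).trans ((le_max_right _ _).trans (le_max_right _ _))) hN
  obtain ⟨hCℓ, hloglog, hℓpow, hℓsqrt⟩ := hN₃ N hNN₃
  have hℓL : Real.log (2 * L) ≤ η * Real.log N := by
    have h1 : Real.log (2 * L) / η ≤ Real.log N := (le_max_left _ _).trans hCℓ
    rw [div_le_iff₀ hη0] at h1
    linarith
  have hℓt : 144 * t ≤ ε₀ * Real.log N := by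
    have h1 : 144 * t / ε₀ ≤ Real.log N := (le_max_right _ _).trans hCℓ
    rw [div_le_iff₀ hε₀] at h1
    linarith
  have hZ0 : 0 ≤ (N : ℝ) ^ ((1 : ℝ) / u) := by positivity
  exact abs_vonMangoldtSum_sub_le_of_cells Ψ K ht hN3 hu2 hε₀ hε₀1 hε₀ε hη2 hηp hηm hΨ hL hc₂0
    hc₂ hℓL hℓt hloglog hℓpow hℓsqrt (hN₂ N hNN₂) (hN₁ N hNN₁ Ψ hΨ hL K hK hKN) (Nat.cast_nonneg _)
    (card_cells_le_primePointCount N _ Ψ K) (primePointCount_le_card_cells_add hZ0 Ψ hΨ K)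
    (primeCounting_le_card_roughPrimes_add N hZ0) (card_roughPrimes_le_primeCounting N _)

end Summit.Parity.GeneralizedHardyLittlewood.Theorems.LeeYangFibresCells
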